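import Mathlib
import HarnessLib
import Literature.Analysis.FluidPDE.SelfSimilar
import Literature.Analysis.FluidPDE.VectorCalculus
import Literature.Analysis.FluidPDE.Vorticity
import Summits.NavierStokesRegularity.NavierStokesRegularity.Theorems.UnthreadedDoorVorticityOfClass
import Summits.NavierStokesRegularity.NavierStokesRegularity.Theorems.UnthreadedDoorToroidalPotential
import Summits.NavierStokesRegularity.NavierStokesRegularity.Theorems.UnthreadedDoorPotentialEvolution
import Summits.NavierStokesRegularity.NavierStokesRegularity.Theorems.UnthreadedDoorConstantOfIrrotational

/-!
# Route `UnthreadedDoor` / `ThreadingFlux`, crux `PoloidalLiouville` (stmt-NavierStokesRegularity-1222): Theorems-side twins of the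
# antidynamo v2 skeleton's stub Props `StubVorticityOfClass` (bridge), `StubToroidalPotential` (2a), `StubPotentialEvolution`
# (2a-evo) and `StubConstantOfIrrotational` (stub 3), so the four registered stubs are closed BY NAME

Bookkeeping file (seat leafhand-ns-unthreadeddoor-1 g0, cell decomp-ns; same pattern as
`UnthreadedDoorAntidynamoStubLevelSetByName.lean`, which closed stub (2a′) by name).  The planner's skeleton
`PoloidalLiouville_antidynamo_birth_v2.lean` (ns-idea-6 g5, sha16 `4ebf5683127b`, registered on stmt-1222 2026-08-28T11:04:57Z) lives in
the planner's HOME and is not importable from `Theorems/`; four of its stubs were PROVED in the tree with their bodies restated, in the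
namespace `…Theorems.PoloidalLiouville`:

* bridge `stub_vorticityOfClass`      — `UnthreadedDoorVorticityOfClass.lean` (KNSS 2009 §4 + Fabes–Jones–Rivière + Majda–Bertozzi Prop. 2.21);
* (2a)   `stub_toroidalPotential`     — `UnthreadedDoorToroidalPotential.lean` (+ `…Construction`, `…Closed`, `…Smooth`; Mie representation);
* (2a-evo) `stub_potentialEvolution` — `UnthreadedDoorPotentialEvolution.lean` (+ `…Core`; the law (E1));
* stub 3 `stub_constantOfIrrotational` — `UnthreadedDoorConstantOfIrrotational.lean` (curl-free Liouville in the duality class).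

Here each Prop is twinned VERBATIM (skeleton ll. 61, 76, 91, 131) in the skeleton's sub-namespace name `Antidynamo`, and each stub is
closed under the skeleton's exact header `theorem stub_X : StubX`.  After this file the composition `PoloidalLiouville_of` of the
skeleton is closed modulo exactly ONE stub, the wall `stub_scalarLiouville : StubScalarLiouville` (2b, XL, open in print beyond
axisymmetry); the plan-only rung `stub_singleDegreeRung` (BC5) is not used by the composition.

HONEST LABEL: bookkeeping; no new mathematics; `stub_scalarLiouville`, `PoloidalLiouville` (1222), the UnthreadedDoor / ThreadingFlux
Targets and NS regularity remain OPEN; nothing here bears on the summit.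
-/

noncomputable section

-- the summit and its single sub-problem share the name (CONVENTIONS §1)
set_option linter.dupNamespace false

open scoped BigOperators Topology MeasureTheory InnerProductSpace RealInnerProductSpace
open Filter Set Function MeasureTheory

namespace Summit.NavierStokesRegularity.NavierStokesRegularity.Theorems.PoloidalLiouville.Antidynamo

/-- STUB (bridge) statement of the antidynamo v2 skeleton (planner ns-idea-6 g5) — twin, body VERBATIM (skeleton l. 61): a bounded
ancient mild solution in the tree's duality class whose velocity is jointly smooth on the open slab solves the VORTICITY FORMULATION
classically on `(−∞,0)` and has bounded vorticity. -/
def StubVorticityOfClass : Prop :=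
  ∀ (v : ℝ → EuclideanSpace ℝ (Fin 3) → EuclideanSpace ℝ (Fin 3)),
    Literature.Analysis.FluidPDE.IsBoundedAncientMildSolution 1 v →
    (∀ t < 0, AEStronglyMeasurable (v t) volume) →
    ContDiffOn ℝ (⊤ : ℕ∞) (Function.uncurry v) (Set.Iio 0 ×ˢ Set.univ) →
    Literature.Analysis.FluidPDE.IsVorticitySolutionOn (Set.Iio 0) 1 v ∧
      ∃ K : ℝ, ∀ t < 0, ∀ x, ‖Literature.Analysis.FluidPDE.curl (v t) x‖ ≤ K

/-- STUB (2a) statement of the antidynamo v2 skeleton — twin, body VERBATIM (skeleton l. 76): the TOROIDAL (Mie/Chandrasekhar)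
POTENTIAL of an unthreaded vorticity field: if `curl v(t)` is tangent to every sphere about `x₀`, there is a scalar `T`, jointly
smooth on the punctured slab, with `curl v(t) = ∇T(t) × (x − x₀)` everywhere and `|T| ≤ π·K`. -/
def StubToroidalPotential : Prop :=
  ∀ (v : ℝ → EuclideanSpace ℝ (Fin 3) → EuclideanSpace ℝ (Fin 3)) (x₀ : EuclideanSpace ℝ (Fin 3)) (K : ℝ),
    ContDiffOn ℝ (⊤ : ℕ∞) (Function.uncurry v) (Set.Iio 0 ×ˢ Set.univ) →
    (∀ t < 0, ∀ x, ‖Literature.Analysis.FluidPDE.curl (v t) x‖ ≤ K) →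
    (∀ t < 0, ∀ x, inner ℝ (x - x₀) (Literature.Analysis.FluidPDE.curl (v t) x) = 0) →
    ∃ T : ℝ → EuclideanSpace ℝ (Fin 3) → ℝ,
      ContDiffOn ℝ (⊤ : ℕ∞) (Function.uncurry T) (Set.Iio 0 ×ˢ ({x₀}ᶜ : Set (EuclideanSpace ℝ (Fin 3)))) ∧
      (∀ t < 0, ∀ x, |T t x| ≤ Real.pi * K) ∧
      ∀ t < 0, ∀ x, Literature.Analysis.FluidPDE.curl (v t) x =
        Literature.Analysis.FluidPDE.cross (gradient (T t) x) (x - x₀)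

/-- STUB (2a-evo) statement of the antidynamo v2 skeleton — twin, body VERBATIM (skeleton l. 91): the EXACT EVOLUTION LAW (E1) of the
toroidal potential in curl form, `∇(∂ₜT + ⟪v, ∇T⟫ − ΔT) × (x − x₀) = ∇⟪v, x − x₀⟫ × ∇T` at every `t < 0`, `x ≠ x₀`. -/
def StubPotentialEvolution : Prop :=
  ∀ (v : ℝ → EuclideanSpace ℝ (Fin 3) → EuclideanSpace ℝ (Fin 3)) (x₀ : EuclideanSpace ℝ (Fin 3))
    (T : ℝ → EuclideanSpace ℝ (Fin 3) → ℝ),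
    Literature.Analysis.FluidPDE.IsVorticitySolutionOn (Set.Iio 0) 1 v →
    ContDiffOn ℝ (⊤ : ℕ∞) (Function.uncurry T) (Set.Iio 0 ×ˢ ({x₀}ᶜ : Set (EuclideanSpace ℝ (Fin 3)))) →
    (∀ t < 0, ∀ x, Literature.Analysis.FluidPDE.curl (v t) x =
      Literature.Analysis.FluidPDE.cross (gradient (T t) x) (x - x₀)) →
    ∀ t < 0, ∀ x, x ≠ x₀ →
      Literature.Analysis.FluidPDE.cross
          (gradient (fun z => deriv (fun s => T s z) t + inner ℝ (v t z) (gradient (T t) z)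
            - Laplacian.laplacian (T t) z) x) (x - x₀) =
        Literature.Analysis.FluidPDE.cross (gradient (fun z => inner ℝ (v t z) (z - x₀)) x) (gradient (T t) x)

/-- STUB 3 statement of the antidynamo v2 skeleton — twin, body VERBATIM (skeleton l. 131): irrotational bounded slices of the class
are constant. -/
def StubConstantOfIrrotational : Prop :=
  ∀ (v : ℝ → EuclideanSpace ℝ (Fin 3) → EuclideanSpace ℝ (Fin 3)),
    Literature.Analysis.FluidPDE.IsBoundedAncientMildSolution 1 v →
    ContDiffOn ℝ (⊤ : ℕ∞) (Function.uncurry v) (Set.Iio 0 ×ˢ Set.univ) →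
    (∀ t < 0, ∀ x, Literature.Analysis.FluidPDE.curl (v t) x = 0) →
    ∀ t < 0, ∃ b : EuclideanSpace ℝ (Fin 3), ∀ x, v t x = b

/-- ★ The registered BRIDGE stub BY NAME: `stub_vorticityOfClass : StubVorticityOfClass` (kernel proof
`PoloidalLiouville.stub_vorticityOfClass`, `UnthreadedDoorVorticityOfClass.lean`).
[cite: KochNadirashviliSereginSverak2009, §4 p. 8 (bounded mild ancient solutions are smooth with bounded derivatives)] -/
theorem stub_vorticityOfClass : StubVorticityOfClass :=
  _root_.Summit.NavierStokesRegularity.NavierStokesRegularity.Theorems.PoloidalLiouville.stub_vorticityOfClass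

/-- ★ The registered KINEMATIC stub (2a) BY NAME: `stub_toroidalPotential : StubToroidalPotential` (kernel proof
`PoloidalLiouville.stub_toroidalPotential`, `UnthreadedDoorToroidalPotential.lean`). [cite: Backus1986, §2 (Mie representation)] -/
theorem stub_toroidalPotential : StubToroidalPotential :=
  _root_.Summit.NavierStokesRegularity.NavierStokesRegularity.Theorems.PoloidalLiouville.stub_toroidalPotential

/-- ★ The registered CALCULUS stub (2a-evo) BY NAME: `stub_potentialEvolution : StubPotentialEvolution` (kernel proof
`PoloidalLiouville.stub_potentialEvolution`, `UnthreadedDoorPotentialEvolution.lean`). [folklore] -/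
theorem stub_potentialEvolution : StubPotentialEvolution :=
  _root_.Summit.NavierStokesRegularity.NavierStokesRegularity.Theorems.PoloidalLiouville.stub_potentialEvolution

/-- ★ The registered SMALL stub 3 BY NAME: `stub_constantOfIrrotational : StubConstantOfIrrotational` (kernel proof
`PoloidalLiouville.stub_constantOfIrrotational`, `UnthreadedDoorConstantOfIrrotational.lean`).
[cite: KochNadirashviliSereginSverak2009, Lemma 3.1 and proof of Thm 5.2, last sentence] -/
theorem stub_constantOfIrrotational : StubConstantOfIrrotational :=
  _root_.Summit.NavierStokesRegularity.NavierStokesRegularity.Theorems.PoloidalLiouville.stub_constantOfIrrotational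

end Summit.NavierStokesRegularity.NavierStokesRegularity.Theorems.PoloidalLiouville.Antidynamo

end
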